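import Summits.ResolutionOfSingularities.ResolutionOfSingularities.Theorems.EquisingularLiftEquisingularLiftNatLinAutTransport
import Summits.ResolutionOfSingularities.ResolutionOfSingularities.Theorems.EquisingularLiftEquisingularLiftBlowupModelQuadrics
import Summits.ResolutionOfSingularities.ResolutionOfSingularities.Theorems.EquisingularLiftEquisingularLiftNatSpecimenLinearCone
import Summits.ResolutionOfSingularities.ResolutionOfSingularities.Theorems.EquisingularLiftEquisingularLiftNatSpecimenSmoothHypersurfaces
import HarnessLib

/-!
# EL♮ (route currency `ELNatAt`) holds for EVERY integral quadric hypersurface of `ℙⁿ⁺¹_k`, every `n`, every characteristic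

[OURS · leafhand-res-equisingularlift-6 g3, 2026-08-31; cell `pub/decomp-res`; items stmt-ResolutionOfSingularities-20038 / -20148 (route decls
`Theses.EquisingularLift.EquisingularLiftNat` / `…NatThree`), -15660] AI-produced, weaker than expert review; NOT a statement of any manuscript; nothing
here proves resolution of singularities in positive characteristic.  DEF-FREE; no `sorry`; standard axioms; ZERO named hypotheses; `--supports … --as helper`.

The honest residual of the two route decls in the stubs' currency (✓ `RouteCurrency.equisingularLiftNat_of_forall_elnatO_primeForms`) is EL♮ at the
non-regular integral hypersurfaces `range ι = V₊(F)`, `F` a prime form of degree `e ≥ 2`.  This file closes its **degree-2 slice in every characteristic**: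

* `linSubst_coeff_apply`, `coeffMatrix_mul_eq_one` — the coefficient matrices of mutually inverse linear substitutions `τ, τ'` (as delivered by
  ✓ `StrataSplit.quadric_normalForm`) form an element `ḡ ∈ GL_{n+2}(k)` with `linSubst ↑ḡ = σ_τ`, `linSubst ↑ḡ⁻¹ = σ_{τ'}`;
* `mem_asHomogeneousIdeal_linAut_hom_iff` / `…_inv_iff`, `range_comp_projectiveSpaceLinAut` — the automorphism `α_ḡ` of `ℙⁿ⁺¹_k`
  (✓ `ProjLinAction.projectiveSpaceLinAut`) acts on points by `q ∈ 𝔮_{α_ḡ x} ↔ linSubst ↑ḡ q ∈ 𝔮_x`, hence moves the binder shape: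
  `range ι = V₊(F) ⟹ range (ι ≫ α_ḡ) = V₊(σ_{τ'} F)`;
* ★★ `elNatAt_quadric` — **for every prime `p`, every algebraically closed `k` of characteristic `p`, every `n`, every closed immersion
  `ι : H ⟶ ℙⁿ⁺¹_k` with `range ι = V₊(F)`, `F` a PRIME QUADRATIC FORM: `Theorems.EquisingularLift.ELNatAt p k (n + 1) H ι`.**  By the normal form
  (✓ `quadric_normalForm`, Literature ✓ `QuadraticFormSingularRadical` / ✓ `QuadraticFormsSmallRank`, EVERY characteristic) `σ_{τ'} F` is a nonsingular
  form — then ✓ `HypersurfaceSpecimen.elNatAt_smoothHypersurface` — or a cone `G(x_ι)` over a nonsingular quadric with linear vertex — then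
  ✓ `LinCone.elNatAt_linCone_of_isNonsingularForm`; EL♮ is carried from `(hypersurface, hypersurfaceι)` to `(H, ι ≫ α_ḡ)` by ✓ `LinAutTransport.elNatAt_of_range_eq`
  and back along `α_ḡ` by ✓ `LinAutTransport.elNatAt_of_elNatAt_comp_projLinAut` (the PGL transport, p819157).

Honest reading: closes no registered stub; the residual remains for prime forms of degree `≥ 3` (non-regular cubic surfaces in `ℙ³` onwards).

References: [Hartshorne1977, I Ex. 5.12, II Example 7.1.1]; [ElmanKarpenkoMerkurjev2008, §7] — through the cited tree files.
-/

set_option linter.dupNamespace false -- mandated namespace `Summit.<Summit>.<Problem>` of this single-conjunct summit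

noncomputable section

open CategoryTheory CategoryTheory.Limits AlgebraicGeometry TopologicalSpace
open MvPolynomial HomogeneousIdeal
open Literature.AlgebraicGeometry.Motives
open Literature.AlgebraicGeometry.Motives.SmoothHypersurface
open Literature.AlgebraicGeometry.Motives.ProjectiveSpaceCells
open Literature.AlgebraicGeometry.GroupSchemes.ProjLinAction
open Summit.ResolutionOfSingularities.ResolutionOfSingularities.Theorems.EquisingularLift
open Summit.ResolutionOfSingularities.ResolutionOfSingularities.Cruxes.EquisingularLift.StrataSplit

namespace Summit.ResolutionOfSingularities.ResolutionOfSingularities.Cruxes.EquisingularLiftNat.Sections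

namespace QuadricELNat

section CoeffMatrix

variable {k : Type} [Field k] {N : ℕ} (τ τ' : Fin (N + 1) → MvPolynomial (Fin (N + 1)) k)
  (hτ : ∀ i, (τ i).IsHomogeneous 1) (hτ' : ∀ i, (τ' i).IsHomogeneous 1)

include hτ in
/-- The matrix substitution by the coefficient matrix `(coeff of xⱼ in τᵢ)` of linear forms `τ` is `σ_τ` (`τᵢ = Σⱼ (coeff xⱼ τᵢ) xⱼ`). [folklore] -/
theorem linSubst_coeff_apply (G : MvPolynomial (Fin (N + 1)) k) :
    Literature.AlgebraicGeometry.GroupSchemes.ProjLinAction.linSubst k (Matrix.of fun i j => coeff (Finsupp.single j 1) (τ i)) G = aeval τ G := by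
  have hfun : (Matrix.of fun i j => coeff (Finsupp.single j 1) (τ i)).toMvPolynomial = τ := by
    funext i
    conv_rhs => rw [eq_lin_of_isHomogeneous_one (hτ i)]
    simp only [Matrix.toMvPolynomial, Matrix.of_apply, lin]
    refine Finset.sum_congr rfl fun j _ => ?_
    rw [X, smul_monomial, smul_eq_mul, mul_one]
  rw [linSubst_apply, hfun]

include hτ' in
/-- `σ_τ ∘ σ_{τ'} = id` on the variables gives `B_{τ'} · B_τ = 1` for the coefficient matrices. [folklore] -/
theorem coeffMatrix_mul_eq_one (hinv : ∀ i, aeval τ (τ' i) = X i) :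
    (Matrix.of fun i j => coeff (Finsupp.single j 1) (τ' i)) * (Matrix.of fun i j => coeff (Finsupp.single j 1) (τ i)) =
      (1 : Matrix (Fin (N + 1)) (Fin (N + 1)) k) := by
  classical
  ext i l
  have h := congrArg (coeff (Finsupp.single l 1)) (hinv i)
  conv_lhs at h => rw [eq_lin_of_isHomogeneous_one (hτ' i), aeval_lin]
  rw [coeff_sum] at h
  simp only [coeff_smul, smul_eq_mul, coeff_X, Finsupp.single_left_inj one_ne_zero] at h
  rw [Matrix.mul_apply, Matrix.one_apply]
  simpa [Matrix.of_apply, eq_comm] using h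

end CoeffMatrix

section Range

variable {k : Type} [Field k] {n : ℕ}

/-- **The action on points** of `Proj.map f`: `q ∈ 𝔮_{(Proj.map f) x} ↔ f q ∈ 𝔮_x` (Mathlib `ProjectiveSpectrum.comap`, `Iff.rfl`; cf.
✓ `StrataSplit.mem_asHomogeneousIdeal_projMap_linSubstGraded_iff`). [folklore] -/
theorem mem_asHomogeneousIdeal_projMap_iff (f : homogeneousSubmodule (Fin (n + 1 + 1)) k →+*ᵍ homogeneousSubmodule (Fin (n + 1 + 1)) k)
    (hf : letI := MvPolynomial.gradedAlgebra (σ := Fin (n + 1 + 1)) (R := k)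
      HomogeneousIdeal.irrelevant (homogeneousSubmodule (Fin (n + 1 + 1)) k) ≤
        (HomogeneousIdeal.irrelevant (homogeneousSubmodule (Fin (n + 1 + 1)) k)).map f)
    (x : (projectiveSpace (n + 1) k).left) (q : MvPolynomial (Fin (n + 1 + 1)) k) :
    letI := MvPolynomial.gradedAlgebra (σ := Fin (n + 1 + 1)) (R := k)
    q ∈ ((Proj.map f hf : (projectiveSpace (n + 1) k).left ⟶ (projectiveSpace (n + 1) k).left) x).asHomogeneousIdeal ↔
      f q ∈ x.asHomogeneousIdeal :=
  Iff.rfl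

/-- `α_g⁻¹ ≫ α_g = 𝟙` on the underlying schemes. [folklore] -/
theorem linAut_inv_left_comp_hom_left (g : GL (Fin (n + 1 + 1)) k) :
    (projectiveSpaceLinAut (n + 1) k g).inv.left ≫ (projectiveSpaceLinAut (n + 1) k g).hom.left = 𝟙 _ := by
  rw [← Over.comp_left, Iso.inv_hom_id, Over.id_left]

/-- Unfolding `α_g` to `Proj.map (linSubst ↑g)` on the underlying schemes. [folklore] -/
theorem linAut_hom_left_eq (g : GL (Fin (n + 1 + 1)) k) :
    letI := MvPolynomial.gradedAlgebra (σ := Fin (n + 1 + 1)) (R := k)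
    (projectiveSpaceLinAut (n + 1) k g).hom.left =
      (Proj.map (Literature.AlgebraicGeometry.GroupSchemes.ProjLinAction.linSubst k (g : Matrix (Fin (n + 1 + 1)) (Fin (n + 1 + 1)) k)) (irrelevant_le_map_linSubst g) :
        (projectiveSpace (n + 1) k).left ⟶ (projectiveSpace (n + 1) k).left) :=
  (projectiveSpaceLinAut_hom_left (n + 1) k g).trans (projLinAut_hom g)

/-- Unfolding `α_g⁻¹` to `Proj.map (linSubst ↑g⁻¹)` on the underlying schemes. [folklore] -/
theorem linAut_inv_left_eq (g : GL (Fin (n + 1 + 1)) k) :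
    letI := MvPolynomial.gradedAlgebra (σ := Fin (n + 1 + 1)) (R := k)
    (projectiveSpaceLinAut (n + 1) k g).inv.left =
      (Proj.map (Literature.AlgebraicGeometry.GroupSchemes.ProjLinAction.linSubst k ((g⁻¹ : GL (Fin (n + 1 + 1)) k) : Matrix (Fin (n + 1 + 1)) (Fin (n + 1 + 1)) k)) (irrelevant_le_map_linSubst g⁻¹) :
        (projectiveSpace (n + 1) k).left ⟶ (projectiveSpace (n + 1) k).left) :=
  (projectiveSpaceLinAut_inv_left (n + 1) k g).trans (projLinAut_inv g)

/-- **The action on points** of `α_g`: `q ∈ 𝔮_{α_g x} ↔ linSubst ↑g q ∈ 𝔮_x`. [folklore] -/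
theorem mem_asHomogeneousIdeal_linAut_hom_iff (g : GL (Fin (n + 1 + 1)) k) (x : (projectiveSpace (n + 1) k).left)
    (q : MvPolynomial (Fin (n + 1 + 1)) k) :
    letI := MvPolynomial.gradedAlgebra (σ := Fin (n + 1 + 1)) (R := k)
    q ∈ ((projectiveSpaceLinAut (n + 1) k g).hom.left x).asHomogeneousIdeal ↔ Literature.AlgebraicGeometry.GroupSchemes.ProjLinAction.linSubst k (g : Matrix (Fin (n + 1 + 1)) (Fin (n + 1 + 1)) k) q ∈ x.asHomogeneousIdeal := by
  letI := MvPolynomial.gradedAlgebra (σ := Fin (n + 1 + 1)) (R := k)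
  have key := congrArg (fun m : (projectiveSpace (n + 1) k).left ⟶ (projectiveSpace (n + 1) k).left =>
    q ∈ (m x).asHomogeneousIdeal) (linAut_hom_left_eq g)
  rw [key]
  exact mem_asHomogeneousIdeal_projMap_iff _ _ x q

/-- **The action on points** of `α_g⁻¹`: `q ∈ 𝔮_{α_g⁻¹ x} ↔ linSubst ↑g⁻¹ q ∈ 𝔮_x`. [folklore] -/
theorem mem_asHomogeneousIdeal_linAut_inv_iff (g : GL (Fin (n + 1 + 1)) k) (x : (projectiveSpace (n + 1) k).left)
    (q : MvPolynomial (Fin (n + 1 + 1)) k) :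
    letI := MvPolynomial.gradedAlgebra (σ := Fin (n + 1 + 1)) (R := k)
    q ∈ ((projectiveSpaceLinAut (n + 1) k g).inv.left x).asHomogeneousIdeal ↔
      Literature.AlgebraicGeometry.GroupSchemes.ProjLinAction.linSubst k ((g⁻¹ : GL (Fin (n + 1 + 1)) k) : Matrix (Fin (n + 1 + 1)) (Fin (n + 1 + 1)) k) q ∈ x.asHomogeneousIdeal := by
  letI := MvPolynomial.gradedAlgebra (σ := Fin (n + 1 + 1)) (R := k)
  have key := congrArg (fun m : (projectiveSpace (n + 1) k).left ⟶ (projectiveSpace (n + 1) k).left =>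
    q ∈ (m x).asHomogeneousIdeal) (linAut_inv_left_eq g)
  rw [key]
  exact mem_asHomogeneousIdeal_projMap_iff _ _ x q

/-- `linSubst ↑g (linSubst ↑g⁻¹ F) = F`. [folklore] -/
theorem linSubst_linSubst_inv (g : GL (Fin (n + 1 + 1)) k) (F : MvPolynomial (Fin (n + 1 + 1)) k) :
    Literature.AlgebraicGeometry.GroupSchemes.ProjLinAction.linSubst k (g : Matrix (Fin (n + 1 + 1)) (Fin (n + 1 + 1)) k) (Literature.AlgebraicGeometry.GroupSchemes.ProjLinAction.linSubst k ((g⁻¹ : GL (Fin (n + 1 + 1)) k) : Matrix (Fin (n + 1 + 1)) (Fin (n + 1 + 1)) k) F) = F := by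
  have h := congrArg (fun f : homogeneousSubmodule (Fin (n + 1 + 1)) k →+*ᵍ homogeneousSubmodule (Fin (n + 1 + 1)) k => f F)
    (linSubst_comp_linSubst_inv (A := k) g)
  simpa using h

/-- **A linear automorphism moves the binder shape**: `range ι = V₊(F)` gives `range (ι ≫ α_g) = V₊(linSubst ↑g⁻¹ F)` (`α_g` acts on points by
`q ∈ 𝔮_{α_g x} ↔ linSubst ↑g q ∈ 𝔮_x`, and `linSubst ↑g (linSubst ↑g⁻¹ F) = F`); sets of points of `ℙⁿ⁺¹_k`. [cite: Hartshorne1977, II Example 7.1.1] -/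
theorem range_comp_projectiveSpaceLinAut (g : GL (Fin (n + 1 + 1)) k) {H : Scheme.{0}} (ι : H ⟶ (projectiveSpace (n + 1) k).left)
    (F : MvPolynomial (Fin (n + 1 + 1)) k)
    (hrange : letI := MvPolynomial.gradedAlgebra (σ := Fin (n + 1 + 1)) (R := k)
      Set.range ι = {x : (projectiveSpace (n + 1) k).left | F ∈ x.asHomogeneousIdeal}) :
    letI := MvPolynomial.gradedAlgebra (σ := Fin (n + 1 + 1)) (R := k)
    Set.range (ι ≫ (projectiveSpaceLinAut (n + 1) k g).hom.left) =
      {x : (projectiveSpace (n + 1) k).left | Literature.AlgebraicGeometry.GroupSchemes.ProjLinAction.linSubst k ((g⁻¹ : GL (Fin (n + 1 + 1)) k) : Matrix (Fin (n + 1 + 1)) (Fin (n + 1 + 1)) k) F ∈ x.asHomogeneousIdeal} := by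
  letI := MvPolynomial.gradedAlgebra (σ := Fin (n + 1 + 1)) (R := k)
  have hβα := linAut_inv_left_comp_hom_left g
  ext y
  rw [Set.mem_setOf_eq]
  constructor
  · rintro ⟨x, rfl⟩
    rw [Scheme.Hom.comp_apply, mem_asHomogeneousIdeal_linAut_hom_iff, linSubst_linSubst_inv]
    have hx : ι x ∈ Set.range ι := ⟨x, rfl⟩
    rw [hrange, Set.mem_setOf_eq] at hx
    exact hx
  · intro hy
    have hyab : (projectiveSpaceLinAut (n + 1) k g).hom.left ((projectiveSpaceLinAut (n + 1) k g).inv.left y) = y := by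
      rw [← Scheme.Hom.comp_apply, hβα]
      rfl
    have hβy := (mem_asHomogeneousIdeal_linAut_inv_iff g y F).mpr hy
    have hmem : (projectiveSpaceLinAut (n + 1) k g).inv.left y ∈ Set.range ι := by
      rw [hrange, Set.mem_setOf_eq]; exact hβy
    obtain ⟨x, hx⟩ := hmem
    exact ⟨x, by rw [Scheme.Hom.comp_apply, hx, hyab]⟩

end Range

/-! ## ★★ EL♮ (route currency) for every integral quadric hypersurface, every characteristic -/

section Quadric

variable {k : Type} [Field k] {n : ℕ}

/-- `V₊(G)` as the set of points of `ℙⁿ⁺¹_k` whose homogeneous prime contains `G` is the image of `hypersurfaceι G`. [folklore] -/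
theorem setOf_mem_eq_range_hypersurfaceι (G : MvPolynomial (Fin (n + 1 + 1)) k) :
    letI := MvPolynomial.gradedAlgebra (σ := Fin (n + 1 + 1)) (R := k)
    {x : (projectiveSpace (n + 1) k).left | G ∈ x.asHomogeneousIdeal} = Set.range (hypersurfaceι G).left := by
  letI := MvPolynomial.gradedAlgebra (σ := Fin (n + 1 + 1)) (R := k)
  rw [range_hypersurfaceι]
  ext x
  change G ∈ x.asHomogeneousIdeal ↔ ({G} : Set (MvPolynomial (Fin (n + 1 + 1)) k)) ⊆ (x.asHomogeneousIdeal : Set _)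
  exact Set.singleton_subset_iff.symm

/-- ★★ **EL♮ HOLDS FOR EVERY INTEGRAL QUADRIC HYPERSURFACE OF `ℙⁿ⁺¹_k`, EVERY `n`, EVERY CHARACTERISTIC** (route currency
`Theorems.EquisingularLift.ELNatAt`).  For a prime `p`, an algebraically closed `k` of characteristic `p`, a closed immersion `ι : H ⟶ ℙⁿ⁺¹_k` with
`range ι = V₊(F)`, `F` a PRIME quadratic form: `ELNatAt p k (n + 1) H ι`.  Proof: the normal form ✓ `StrataSplit.quadric_normalForm` (all
characteristics) gives an invertible linear substitution after which `F` is a nonsingular form (then ✓ `HypersurfaceSpecimen.elNatAt_smoothHypersurface`)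
or a cone `rename ι G` over a nonsingular quadric with linear vertex (then ✓ `LinCone.elNatAt_linCone_of_isNonsingularForm`); the substitution is the
automorphism `α_ḡ` of `ℙⁿ⁺¹_k` of its coefficient matrix `ḡ ∈ GL_{n+2}(k)` (`range_comp_projectiveSpaceLinAut`), and EL♮ comes back along `α_ḡ` by
✓ `LinAutTransport.elNatAt_of_elNatAt_comp_projLinAut` and ✓ `LinAutTransport.elNatAt_of_range_eq`.  The degree-2 slice of the honest residual
✓ `RouteCurrency.equisingularLiftNat_of_forall_elnatO_primeForms` of the route decls of stmt-…-20038 / -20148, closed in every characteristic.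
[cite: Hartshorne1977, I Ex. 5.12 and II Example 7.1.1] -/
theorem elNatAt_quadric (p : ℕ) (hp : p.Prime) (k : Type) [Field k] [CharP k p] [IsAlgClosed k] {n : ℕ}
    {H : Scheme.{0}} (ι : H ⟶ (projectiveSpace (n + 1) k).left) [IsClosedImmersion ι]
    (F : MvPolynomial (Fin (n + 1 + 1)) k) (hF : F.IsHomogeneous 2) (hprime : Prime F)
    (hrange : letI := MvPolynomial.gradedAlgebra (σ := Fin (n + 1 + 1)) (R := k)
      Set.range ι = {x : Proj (homogeneousSubmodule (Fin (n + 1 + 1)) k) | F ∈ x.asHomogeneousIdeal}) :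
    ELNatAt p k (n + 1) H ι := by
  classical
  letI := MvPolynomial.gradedAlgebra (σ := Fin (n + 1 + 1)) (R := k)
  have hrange' : Set.range ι = {x : (projectiveSpace (n + 1) k).left | F ∈ x.asHomogeneousIdeal} := hrange
  obtain ⟨τ, τ', hτ, hτ', hinv, hinv', hcases⟩ := quadric_normalForm F hF hprime
  -- the coefficient matrices of `τ`, `τ'` form an element of `GL_{n+2}(k)`
  have h1 : (Matrix.of fun i j => coeff (Finsupp.single j 1) (τ i)) * (Matrix.of fun i j => coeff (Finsupp.single j 1) (τ' i)) =
      (1 : Matrix (Fin (n + 1 + 1)) (Fin (n + 1 + 1)) k) := coeffMatrix_mul_eq_one τ' τ hτ hinv'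
  have h2 : (Matrix.of fun i j => coeff (Finsupp.single j 1) (τ' i)) * (Matrix.of fun i j => coeff (Finsupp.single j 1) (τ i)) =
      (1 : Matrix (Fin (n + 1 + 1)) (Fin (n + 1 + 1)) k) := coeffMatrix_mul_eq_one τ τ' hτ' hinv
  let gk : GL (Fin (n + 1 + 1)) k :=
    ⟨Matrix.of fun i j => coeff (Finsupp.single j 1) (τ i), Matrix.of fun i j => coeff (Finsupp.single j 1) (τ' i), h1, h2⟩
  have hginv : ((gk⁻¹ : GL (Fin (n + 1 + 1)) k) : Matrix (Fin (n + 1 + 1)) (Fin (n + 1 + 1)) k) = Matrix.of fun i j => coeff (Finsupp.single j 1) (τ' i) := rfl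
  have hrange₁ : Set.range (ι ≫ (projectiveSpaceLinAut (n + 1) k gk).hom.left) =
      {x : (projectiveSpace (n + 1) k).left | aeval τ' F ∈ x.asHomogeneousIdeal} := by
    rw [range_comp_projectiveSpaceLinAut gk ι F hrange', hginv, linSubst_coeff_apply τ' hτ']
  refine LinAutTransport.elNatAt_of_elNatAt_comp_projLinAut p k (n + 1) H ι gk ?_
  rcases hcases with hns | ⟨m, r, ιm, e, G, hm, hιm, he, hιe, heι, hG, hGns, hFG⟩
  · -- `σ_{τ'} F` nonsingular: a smooth quadric (`n ≥ 1`; a prime binary quadratic form does not exist)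
    rcases Nat.eq_zero_or_pos n with hn | hn
    · subst hn
      exact absurd hprime.irreducible (not_irreducible_of_isHomogeneous_two_fin_two hF)
    · refine LinAutTransport.elNatAt_of_range_eq p k (n + 1) _ (hypersurfaceι (aeval τ' F)).left ?_
        (HypersurfaceSpecimen.elNatAt_smoothHypersurface p hp k hn (aeval τ' F)
          (isHomogeneous_two_aeval_of_linSubst τ' hτ' hF) (by norm_num) hns)
      rw [hrange₁, setOf_mem_eq_range_hypersurfaceι]
  · -- `σ_{τ'} F = G(x_ι)`: a cone with vertex `ℙʳ` over the nonsingular quadric `G`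
    refine LinAutTransport.elNatAt_of_range_eq p k (n + 1) _ (hypersurfaceι (rename ιm G)).left ?_
      (LinCone.elNatAt_linCone_of_isNonsingularForm p hp k hm ιm hιm e he hιe heι G hG (by norm_num) hGns)
    rw [hrange₁, hFG, setOf_mem_eq_range_hypersurfaceι]

end Quadric

end QuadricELNat

end Summit.ResolutionOfSingularities.ResolutionOfSingularities.Cruxes.EquisingularLiftNat.Sections

end
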